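import Literature.AlgebraicGeometry.Motives.HodgeStructure
import Literature.AlgebraicGeometry.Motives.HodgeStructureSubstructures
import Summits.HodgeConjecture.HodgeConjecture.Theorems.Q8SymplecticPowersTransportRestriction
import HarnessLib

/-!
# Route `Q8SymplecticPowers`, crux K1Q (stmt-HodgeConjecture-24190), stub S4: the finite-orbit span is
# `τ²`-invariant once `ker(A_ℂ − i)` is irreducible under every finite-index monodromy subgroup (pure algebra)

Prover seat `hodge-nonav-20241-p1` (g22); helper `--supports stmt-HodgeConjecture-24190`. This is the linear
algebra behind conjunct (iv) «`N ≤ ker(A² − 1)`» of the registered stub S4 `stub_transcendentalQuaternionicPartQ`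
(skeleton v6 of line «mechanism-v2»), isolated from the family: for `Γ ≤ GL_ℚ(H)`, `A ∈ End H` with `A⁴ = 1`
commuting with `Γ`, and `N` = the span of the vectors fixed by some finite-index subgroup of `Γ` (the
registered finite-orbit span), IF every finite-index `Γ' ≤ Γ` acts irreducibly on `M := ker(A_ℂ − i)` through
`γ ⊗ ℂ` and `dim M ≥ 2`, THEN `N ≤ ker(A² − 1)` (`span_finiteIndexFixed_le_eigenspace_sq_one_of_irreducible`).
Proof: `N` is `Γ`- and `A`-stable (`span_fixed_map_mem(_of_comm)`) and pointwise fixed by one finite-index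
`Γ₀` (`exists_finiteIndex_normal_span_fixed_iff`); `P := (N ∩ ker(A²+1)) ⊗ ℂ ∩ M` is `Γ₀`-stable inside `M`,
so `P ∈ {0, M}`; `P = M` makes `Γ₀` trivial on `M` and a line of `M` stable — excluded by `dim M ≥ 2`;
`P = 0` gives, for `n ∈ N ∩ ker(A²+1)` and `x = 1 ⊗ n`, `x − i·A x ∈ P = 0`, so `A x = −i x`, and by complex
conjugation (`x`, `A` real) `A x = i x`, whence `x = 0`, `n = 0`; finally `n − A² n ∈ N ∩ ker(A²+1) = 0` for
every `n ∈ N`. §1 carries four small base-change helpers (stable subspaces, pointwise-fixed subspaces,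
`1 ⊗ v = 0 ⇒ v = 0` by flatness of `ℂ/ℚ`, membership in the base change of an eigenspace).

Consumed by `Q8SymplecticPowersTranscendentalIrreducibleOfFlatSpan` (S4 (iii) ∧ (iv) from one flat-span
certificate). HONEST FRAMING: pure algebra; nothing here proves S4, K1Q or HC.
-/

noncomputable section

set_option linter.dupNamespace false

namespace Summit.HodgeConjecture.HodgeConjecture.Theorems.Q8SymplecticPowersFiniteOrbitInvariantOfIrreducible

open scoped TensorProduct
open Literature.AlgebraicGeometry.Motives
open Summit.HodgeConjecture.HodgeConjecture.Theorems.Q8SymplecticPowersTransportRestriction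

/-! ### §1 Linear algebra: base change of stable subspaces; `1 ⊗ v = 0 ⇒ v = 0` -/

section LinearAlgebra

variable {H : Type*} [AddCommGroup H] [Module ℚ H]

/-- A `ℚ`-linear map sending `N` into `N'` sends `N ⊗ ℂ` into `N' ⊗ ℂ` after base change. [folklore] -/
theorem baseChange_apply_mem_baseChange {H' : Type*} [AddCommGroup H'] [Module ℚ H'] (f : H →ₗ[ℚ] H')
    {N : Submodule ℚ H} {N' : Submodule ℚ H'} (hf : ∀ x ∈ N, f x ∈ N') {y : ℂ ⊗[ℚ] H}
    (hy : y ∈ N.baseChange ℂ) : f.baseChange ℂ y ∈ N'.baseChange ℂ := by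
  rw [Submodule.baseChange_eq_span] at hy
  induction hy using Submodule.span_induction with
  | mem z hz =>
    obtain ⟨v, hv, rfl⟩ := Submodule.mem_map.1 hz
    change f.baseChange ℂ ((1 : ℂ) ⊗ₜ[ℚ] v) ∈ _
    rw [LinearMap.baseChange_tmul]
    exact Submodule.tmul_mem_baseChange_of_mem 1 (hf v hv)
  | zero => rw [map_zero]; exact Submodule.zero_mem _
  | add y z _ _ hy hz => rw [map_add]; exact Submodule.add_mem _ hy hz
  | smul c y _ hy => rw [map_smul]; exact Submodule.smul_mem _ c hy

/-- An automorphism fixing `N` pointwise fixes `N ⊗ ℂ` pointwise after base change. [folklore] -/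
theorem baseChange_apply_eq_self_of_forall {N : Submodule ℚ H} (f : H →ₗ[ℚ] H) (hf : ∀ x ∈ N, f x = x)
    {y : ℂ ⊗[ℚ] H} (hy : y ∈ N.baseChange ℂ) : f.baseChange ℂ y = y := by
  rw [Submodule.baseChange_eq_span] at hy
  induction hy using Submodule.span_induction with
  | mem z hz =>
    obtain ⟨v, hv, rfl⟩ := Submodule.mem_map.1 hz
    change f.baseChange ℂ ((1 : ℂ) ⊗ₜ[ℚ] v) = (1 : ℂ) ⊗ₜ[ℚ] v
    rw [LinearMap.baseChange_tmul, hf v hv]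
  | zero => rw [map_zero]
  | add y z _ _ hy hz => rw [map_add, hy, hz]
  | smul c y _ hy => rw [map_smul, hy]

/-- `1 ⊗ v = 0` in `ℂ ⊗_ℚ H` forces `v = 0` (`ℚ ↪ ℂ` stays injective after `- ⊗_ℚ H`, every
`ℚ`-module being flat). [folklore] -/
theorem eq_zero_of_one_tmul_eq_zero {v : H} (hv : (1 : ℂ) ⊗ₜ[ℚ] v = 0) : v = 0 := by
  have hinj : Function.Injective ((Algebra.linearMap ℚ ℂ).rTensor H) :=
    Module.Flat.rTensor_preserves_injective_linearMap _ (algebraMap ℚ ℂ).injective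
  have h1 : (Algebra.linearMap ℚ ℂ).rTensor H ((1 : ℚ) ⊗ₜ[ℚ] v) = 0 := by
    rw [LinearMap.rTensor_tmul, Algebra.linearMap_apply, map_one, hv]
  have h2 : (1 : ℚ) ⊗ₜ[ℚ] v = 0 := hinj (by rw [h1, map_zero])
  have h3 := congrArg (TensorProduct.lid ℚ H) h2
  rwa [TensorProduct.lid_tmul, one_smul, map_zero] at h3

/-- Membership in the base change of an eigenspace: `x ∈ ker(f − μ) ⊗ ℂ ↔ (f ⊗ ℂ) x = μ • x`
(kernels commute with the flat base change `ℂ/ℚ`). [folklore] -/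
theorem mem_baseChange_eigenspace_iff (f : H →ₗ[ℚ] H) (μ : ℚ) (x : ℂ ⊗[ℚ] H) :
    x ∈ (Module.End.eigenspace f μ).baseChange ℂ ↔ f.baseChange ℂ x = (μ : ℂ) • x := by
  have hker : Module.End.eigenspace f μ = LinearMap.ker (f - μ • LinearMap.id) := by
    ext v
    rw [Module.End.mem_eigenspace_iff, LinearMap.mem_ker, LinearMap.sub_apply, LinearMap.smul_apply,
      LinearMap.id_apply, sub_eq_zero]
  rw [hker, HodgeStructure.mem_baseChange_ker_iff, LinearMap.baseChange_sub, LinearMap.sub_apply,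
    sub_eq_zero, LinearMap.baseChange_smul, LinearMap.smul_apply, LinearMap.baseChange_id,
    LinearMap.id_apply]
  have hμ : (μ : ℂ) • x = μ • x := by rw [← algebraMap_smul ℂ μ x, eq_ratCast]
  rw [hμ]

end LinearAlgebra

/-! ### §2 (iv) from the irreducibility of `ker(A_ℂ − i)` -/

section FiniteOrbit

variable {H : Type*} [AddCommGroup H] [Module ℚ H] [Module.Finite ℚ H]

/-- **Finite-orbit classes are `A²`-invariant when `M := ker(A_ℂ − i)` is irreducible under every
finite-index subgroup and `dim M ≥ 2`.** `Γ ≤ GL(H)`, `A ∈ End H` with `A⁴ = 1` commuting with `Γ`,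
`N` the span of the vectors fixed by some finite-index subgroup of `Γ`. If every finite-index
`Γ' ≤ Γ` acts irreducibly on `M` through `γ ⊗ ℂ`, and `dim M ≥ 2`, then `N ≤ ker(A² − 1)`. (Proof:
`N` is `Γ`- and `A`-stable and fixed pointwise by one finite-index `Γ₀`; `P := (N ∩ ker(A²+1)) ⊗ ℂ ∩ M`
is `Γ₀`-stable, so `P = 0` or `P = M`; `P = M` makes `Γ₀` trivial on `M`, so a line of `M` is
stable — impossible; `P = 0` gives, for `n ∈ N ∩ ker(A²+1)` and `x = 1 ⊗ n`, `x − i A x ∈ P = 0`,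
so `A x = −i x`, and by complex conjugation (`x`, `A` real) `A x = i x`, whence `x = 0`, `n = 0`;
finally `n − A² n ∈ N ∩ ker(A²+1) = 0` for `n ∈ N`.) [cite: Deligne1987, §1.12 (p. 10)] -/
theorem span_finiteIndexFixed_le_eigenspace_sq_one_of_irreducible
    (Γ : Subgroup (H ≃ₗ[ℚ] H)) (A : H →ₗ[ℚ] H) (hA4 : A ^ 4 = 1)
    (hAΓ : ∀ γ ∈ Γ, ∀ x, γ (A x) = A (γ x))
    (h2 : 2 ≤ Module.finrank ℂ ↥(Module.End.eigenspace (A.baseChange ℂ) Complex.I))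
    (hirr : ∀ Γ' : Subgroup (H ≃ₗ[ℚ] H), Γ' ≤ Γ → (Γ'.subgroupOf Γ).FiniteIndex →
      ∀ F : Submodule ℂ (ℂ ⊗[ℚ] H), F ≤ Module.End.eigenspace (A.baseChange ℂ) Complex.I →
        (∀ γ ∈ Γ', ∀ x ∈ F, ((γ : H →ₗ[ℚ] H).baseChange ℂ) x ∈ F) →
        F = ⊥ ∨ F = Module.End.eigenspace (A.baseChange ℂ) Complex.I) :
    Submodule.span ℚ {x : H | ∃ Γ' : Subgroup (H ≃ₗ[ℚ] H), Γ' ≤ Γ ∧ (Γ'.subgroupOf Γ).FiniteIndex ∧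
      ∀ γ ∈ Γ', γ x = x} ≤ Module.End.eigenspace (A ^ 2) 1 := by
  classical
  set M := Module.End.eigenspace (A.baseChange ℂ) Complex.I with hM
  set N := Submodule.span ℚ {x : H | ∃ Γ' : Subgroup (H ≃ₗ[ℚ] H), Γ' ≤ Γ ∧ (Γ'.subgroupOf Γ).FiniteIndex ∧
      ∀ γ ∈ Γ', γ x = x} with hN
  -- `A²` basics
  have hA2 : ∀ x, (A ^ 2) x = A (A x) := fun x ↦ by rw [pow_two, Module.End.mul_apply]
  have hA4' : ∀ x, (A ^ 2) ((A ^ 2) x) = x := fun x ↦ by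
    rw [← Module.End.mul_apply, ← pow_add, show 2 + 2 = 4 from rfl, hA4, Module.End.one_apply]
  -- `N` is `Γ`-stable and `A`-stable
  have hNΓ : ∀ γ ∈ Γ, ∀ x ∈ N, γ x ∈ N := fun γ hγ x hx ↦ span_fixed_map_mem Γ hγ hx
  have hNA : ∀ x ∈ N, A x ∈ N := fun x hx ↦ span_fixed_map_mem_of_comm Γ (f := A) hAΓ hx
  -- one finite-index `Γ₀ ≤ Γ` fixing `N` pointwise
  obtain ⟨Γ₀, hΓ₀le, hΓ₀fi, -, hΓ₀⟩ := exists_finiteIndex_normal_span_fixed_iff (K := ℚ) Γ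
  -- `N₋ := N ∩ ker(A² + 1)` is `Γ`- and `A`-stable
  set Nm := N ⊓ Module.End.eigenspace (A ^ 2) (-1) with hNm
  have hNmA : ∀ x ∈ Nm, A x ∈ Nm := fun x hx ↦
    ⟨hNA x hx.1, apply_mem_eigenspace_of_comm (f := A ^ 2) (g := A) (fun y ↦ by rw [hA2, hA2]) hx.2⟩
  have hNmΓ : ∀ γ ∈ Γ, ∀ x ∈ Nm, γ x ∈ Nm := fun γ hγ x hx ↦
    ⟨hNΓ γ hγ x hx.1, apply_mem_eigenspace_of_comm (f := A ^ 2) (g := (γ : H →ₗ[ℚ] H))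
      (fun y ↦ by rw [hA2, hA2, LinearEquiv.coe_coe, hAΓ γ hγ, hAΓ γ hγ]) hx.2⟩
  -- `A_ℂ` commutes with `γ ⊗ ℂ`
  have hAΓC : ∀ γ ∈ Γ, ∀ y : ℂ ⊗[ℚ] H, ((γ : H →ₗ[ℚ] H).baseChange ℂ) (A.baseChange ℂ y) =
      A.baseChange ℂ (((γ : H →ₗ[ℚ] H).baseChange ℂ) y) := by
    intro γ hγ y
    have hc : (γ : H →ₗ[ℚ] H) ∘ₗ A = A ∘ₗ (γ : H →ₗ[ℚ] H) := LinearMap.ext fun x ↦ hAΓ γ hγ x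
    have := congrArg (fun f : H →ₗ[ℚ] H ↦ f.baseChange ℂ y) hc
    simpa only [LinearMap.baseChange_comp, LinearMap.comp_apply] using this
  -- `P := N₋ ⊗ ℂ ∩ M` is `Γ₀`-stable inside `M`
  have hP : ∀ γ ∈ Γ₀, ∀ x ∈ Nm.baseChange ℂ ⊓ M,
      ((γ : H →ₗ[ℚ] H).baseChange ℂ) x ∈ Nm.baseChange ℂ ⊓ M :=
    fun γ hγ x hx ↦ ⟨baseChange_apply_mem_baseChange _ (hNmΓ γ (hΓ₀le hγ)) hx.1,
      apply_mem_eigenspace_of_comm (f := A.baseChange ℂ) (g := (γ : H →ₗ[ℚ] H).baseChange ℂ)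
        (hAΓC γ (hΓ₀le hγ)) hx.2⟩
  rcases hirr Γ₀ hΓ₀le hΓ₀fi (Nm.baseChange ℂ ⊓ M) inf_le_right hP with h0 | h1
  · -- `P = 0`: then `N₋ = 0`
    have hNm0 : ∀ n ∈ Nm, n = 0 := by
      intro n hn
      have hxNm : (1 : ℂ) ⊗ₜ[ℚ] n ∈ Nm.baseChange ℂ := Submodule.tmul_mem_baseChange_of_mem 1 hn
      have hAx : A.baseChange ℂ ((1 : ℂ) ⊗ₜ[ℚ] n) = (1 : ℂ) ⊗ₜ[ℚ] A n := by
        rw [LinearMap.baseChange_tmul]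
      have hAAx : A.baseChange ℂ (A.baseChange ℂ ((1 : ℂ) ⊗ₜ[ℚ] n)) = -((1 : ℂ) ⊗ₜ[ℚ] n) := by
        rw [hAx, LinearMap.baseChange_tmul, ← hA2, Module.End.mem_eigenspace_iff.1 hn.2, neg_one_smul,
          TensorProduct.tmul_neg]
      -- `y := x − i • A x ∈ P`
      have hy : (1 : ℂ) ⊗ₜ[ℚ] n - Complex.I • A.baseChange ℂ ((1 : ℂ) ⊗ₜ[ℚ] n) ∈ Nm.baseChange ℂ ⊓ M := by
        refine Submodule.mem_inf.2 ⟨Submodule.sub_mem _ hxNm (Submodule.smul_mem _ _ ?_), ?_⟩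
        · rw [hAx]; exact Submodule.tmul_mem_baseChange_of_mem 1 (hNmA n hn)
        · rw [Module.End.mem_eigenspace_iff, map_sub, map_smul, hAAx, smul_sub, smul_neg, smul_smul,
            Complex.I_mul_I, neg_one_smul, sub_neg_eq_add, sub_neg_eq_add, add_comm]
      rw [h0, Submodule.mem_bot, sub_eq_zero] at hy
      -- `x = i • A x`, hence `A x = -i • x`
      have hAx' : A.baseChange ℂ ((1 : ℂ) ⊗ₜ[ℚ] n) = -(Complex.I • ((1 : ℂ) ⊗ₜ[ℚ] n)) := by
        have := congrArg (A.baseChange ℂ) hy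
        rw [map_smul, hAAx, smul_neg] at this
        exact this
      -- complex conjugation: `x` and `A` are real, so `A x = i • x` as well
      have hreal : HodgeStructure.conj ((1 : ℂ) ⊗ₜ[ℚ] n) = (1 : ℂ) ⊗ₜ[ℚ] n := by
        rw [HodgeStructure.conj_tmul, map_one]
      have hconj := HodgeStructure.conj_baseChange A ((1 : ℂ) ⊗ₜ[ℚ] n)
      rw [hreal, hAx', map_neg, HodgeStructure.conj_smul, hreal, Complex.conj_I, neg_smul, neg_neg] at hconj
      -- `hconj : i • x = -(i • x)`
      have hx0 : (1 : ℂ) ⊗ₜ[ℚ] n = 0 := by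
        have h2x : (2 : ℂ) • (Complex.I • ((1 : ℂ) ⊗ₜ[ℚ] n)) = 0 := by
          rw [two_smul]
          nth_rewrite 2 [hconj]
          exact add_neg_cancel _
        rcases smul_eq_zero.1 h2x with h | h
        · norm_num at h
        · rcases smul_eq_zero.1 h with h' | h'
          · exact absurd h' Complex.I_ne_zero
          · exact h'
      exact eq_zero_of_one_tmul_eq_zero hx0
    intro n hn
    -- `n − A² n ∈ N₋ = 0`
    have hmem : n - (A ^ 2) n ∈ Nm := by
      refine Submodule.mem_inf.2 ⟨Submodule.sub_mem _ hn ?_, ?_⟩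
      · rw [hA2]; exact hNA _ (hNA n hn)
      · rw [Module.End.mem_eigenspace_iff, map_sub, hA4', neg_one_smul, neg_sub]
    have h := hNm0 _ hmem
    rw [sub_eq_zero] at h
    rw [Module.End.mem_eigenspace_iff, one_smul]
    exact h.symm
  · -- `P = M`: `Γ₀` acts trivially on `M`; a line of `M` is then stable — contradiction
    exfalso
    have hMle : M ≤ N.baseChange ℂ := fun x hx ↦ by
      have hx' : x ∈ Nm.baseChange ℂ ⊓ M := by rw [h1]; exact hx
      exact Submodule.baseChange_mono ℂ (inf_le_left : Nm ≤ N) hx'.1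
    have hfix : ∀ γ ∈ Γ₀, ∀ x ∈ M, ((γ : H →ₗ[ℚ] H).baseChange ℂ) x = x := fun γ hγ x hx ↦
      baseChange_apply_eq_self_of_forall (N := N) _ (fun v hv ↦ (hΓ₀ v).1 hv γ hγ) (hMle hx)
    have hM0 : M ≠ ⊥ := fun h ↦ by
      rw [h, finrank_bot] at h2
      exact absurd h2 (by norm_num)
    obtain ⟨v, hvM, hv0⟩ := Submodule.exists_mem_ne_zero_of_ne_bot hM0
    have hline : (ℂ ∙ v) ≤ M := (Submodule.span_singleton_le_iff_mem v M).2 hvM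
    rcases hirr Γ₀ hΓ₀le hΓ₀fi (ℂ ∙ v) hline
        (fun γ hγ x hx ↦ by rw [hfix γ hγ x (hline hx)]; exact hx) with hl | hl
    · exact hv0 ((Submodule.span_singleton_eq_bot).1 hl)
    · have h1' := finrank_span_singleton (K := ℂ) hv0
      rw [hl] at h1'
      rw [h1'] at h2
      exact absurd h2 (by norm_num)

end FiniteOrbit

end Summit.HodgeConjecture.HodgeConjecture.Theorems.Q8SymplecticPowersFiniteOrbitInvariantOfIrreducible

end
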